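import Summits.QuantumAdvantage.QuantumAdvantage.Theorems.MobiusLadderLiouvilleOrthogonalTC0StubDrstRecursion
import Summits.QuantumAdvantage.QuantumAdvantage.Theorems.MobiusLadderLiouvilleOrthogonalTC0StubDrstAS
import Summits.QuantumAdvantage.QuantumAdvantage.Theorems.MobiusLadderLiouvilleOrthogonalTC0StubPtfBlock
import Summits.QuantumAdvantage.QuantumAdvantage.Theorems.MobiusLadderLiouvilleOrthogonalTC0StubPtfRung
import Summits.QuantumAdvantage.QuantumAdvantage.Theorems.MobiusLadderLiouvilleOrthogonalTC0StubPeriodicRung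
import Summits.QuantumAdvantage.QuantumAdvantage.Theorems.MobiusLadderLiouvilleOrthogonalTC0StubSpectralMoebius
import Summits.QuantumAdvantage.QuantumAdvantage.Theorems.MobiusLadderLiouvilleOrthogonalTC0DepthOne
import Summits.QuantumAdvantage.QuantumAdvantage.Theorems.MobiusLadderLiouvilleOrthogonalTC0SizeRung
import HarnessLib

/-!
# Crux `MobiusLadder.LiouvilleOrthogonalTC0` (stmt-QuantumAdvantage-1393), line `Sketch`, skeleton v10:
# the PTF rung and the periodic rung (unconditional), with their Möbius (Kalai) twins

Wave 3 of lead `c6` landed the four stubs of the PTF rung (`stub_drstRecursion` p141466,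
`stub_drstAS` p141376, `stub_ptfBlock` p141321, `stub_ptfRung` p141035), the periodic rung
(`PeriodicRung.stub_periodic` p141313) and the `μ`-form of the spectral criterion
(`stub_spectral_moebius` p141074). This file composes them into citable theorems:

* `ptf_sum_card_pivotal_le` — **Diakonikolas–Raghavendra–Servedio–Tan** (arXiv:0909.5011, Thm 1.2,
  elementary form), PROVED: every real function `q` on `{0,1}^m` of Fourier degree `≤ d` has
  `Σ_ω #{i : [0 ≤ q ω] ≠ [0 ≤ q ω^{(i)}]} ≤ 2 m^{1−1/2^d} 2^m`, i.e. the degree-`d` polynomial threshold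
  function `[q ≥ 0]` has average sensitivity `≤ 2 m^{1−1/2^d}`; `ptf_sum_card_blockFlip_le` — the same
  for block sensitivity w.r.t. any `m`-block labelling of `{0,1}ⁿ`; `tailWeight_ptf_le` — hence the
  Fourier tail `W^{≥ m}[sgn(b ⊕ [0 ≤ p])] ≤ 6 m^{−1/2^d} + 3/√m`, uniformly in `n`.
* `liouville_orthogonal_ptf` — **the PTF rung (unconditional)**: for every `d` and `ε > 0`, eventually
  in `n`, every polynomial threshold function of Fourier degree `≤ d` in the `n` binary digits (e.g. a
  majority vote with arbitrary real weights among polynomially many `AND`/`OR`s of `≤ d` literals —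
  every depth-two `THR ∘ AND_{≤ d}` circuit — or the sign of a real polynomial of degree `d` in the
  bits) has `|Σ_{N<2ⁿ} λ(N) sgn(b ⊕ [0 ≤ p(bits N)])| ≤ ε 2ⁿ`; `liouville_orthogonal_circuit_ptf` — the
  same for every circuit (any basis, depth, size) computing such a function.
* `moebius_orthogonal_ptf`, `moebius_orthogonal_circuit_ptf` — **Kalai's `TC⁰` conjecture holds on
  polynomial threshold functions of bounded degree** (unconditional; `stub_spectral_moebius`).
* `moebius_orthogonal_ltf`, `moebius_orthogonal_size_le` — Kalai's conjecture on linear threshold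
  functions of the digits (Peres' tail `tailWeight_ltf_le`) and on `tcBasis` circuits with `≤ K` gates
  (`tailWeight_circuit_size_le`), the `μ`-twins of the v4/v5 rungs.
* `orthogonal_periodic_of_progression` — the periodic rung for ANY weight `f` with `f 0 = 0` obeying a
  Siegel–Walfisz bound in progressions; the periodic rung for `λ` is `PeriodicRung.stub_periodic`,
  and `moebius_orthogonal_periodic` — **the periodic rung for `λ` and for `μ` (unconditional)**: for
  every `A` and `ε > 0`, eventually in `n`, `|Σ_{N<2ⁿ} μ(N) g(N mod q)| ≤ ε 2ⁿ` for all `1 ≤ q ≤ n^A` and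
  all `1`-bounded `g` (tree: `SiegelWalfiszMoebius_holds`, Montgomery–Vaughan §11.3).
-/

set_option linter.dupNamespace false -- D-0017: single-problem summit ⇒ `QuantumAdvantage.QuantumAdvantage` by design

noncomputable section

namespace Summit.QuantumAdvantage.QuantumAdvantage.Theorems.LiouvilleOrthogonalTC0

open Filter Finset Topology ArithmeticFunction
open Literature.Computability.Complexity
open Literature.Computability.Complexity.LowDegree (tailWeight)
open Literature.Probability.RandomGraphs.LowDegree (sgn)
open Literature.NumberTheory.LFunctions

/-! ### Average and block sensitivity of bounded-degree PTFs (DRST, proved) -/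

/-- **Diakonikolas–Raghavendra–Servedio–Tan, Theorem 1.2 (elementary form), PROVED.** Every real
function `q` on the cube `{0,1}^m` of Fourier degree `≤ d` has at most `2 m^{1−1/2^d} 2^m` pairs
(point, pivotal coordinate) for the polynomial threshold function `[0 ≤ q]`, i.e. average
sensitivity `AS([q ≥ 0]) ≤ 2 m^{1−1/2^d}` (`stub_drstAS` ∘ `stub_drstRecursion`). -/
theorem ptf_sum_card_pivotal_le (m d : ℕ) (q : (Fin m → Bool) → ℝ) (hq : fourierDegree q ≤ d) :
    ∑ ω : Fin m → Bool, ((Finset.univ.filter fun i : Fin m =>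
        decide (0 ≤ q ω) ≠ decide (0 ≤ q (Function.update ω i (!ω i)))).card : ℝ)
      ≤ 2 * (m : ℝ) ^ ((1 : ℝ) - 1 / 2 ^ d) * (2 : ℝ) ^ m :=
  stub_drstAS stub_drstRecursion m d q hq

/-- **Block sensitivity of bounded-degree PTFs, PROVED.** For every real `p` on `{0,1}ⁿ` of Fourier
degree `≤ d` and every block labelling `π : Fin n → Fin m`, the number of pairs (point `x`, block `j`)
with `[0 ≤ p x] ≠ [0 ≤ p (x with block π⁻¹(j) flipped)]` is at most `2 m^{1−1/2^d} 2ⁿ`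
(`stub_ptfBlock` over `ptf_sum_card_pivotal_le`). -/
theorem ptf_sum_card_blockFlip_le (n m d : ℕ) (p : (Fin n → Bool) → ℝ) (hp : fourierDegree p ≤ d)
    (π : Fin n → Fin m) :
    ∑ x : Fin n → Bool, ((Finset.univ.filter fun j : Fin m =>
        decide (0 ≤ p x) ≠ decide (0 ≤ p (fun i => xor (x i) (decide (π i = j))))).card : ℝ)
      ≤ 2 * (m : ℝ) ^ ((1 : ℝ) - 1 / 2 ^ d) * (2 : ℝ) ^ n :=
  stub_ptfBlock (fun m d q hq => ptf_sum_card_pivotal_le m d q hq) p hp π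

/-- **Uniform Fourier tails of bounded-degree PTFs, PROVED.** For `fourierDegree p ≤ d`, `b : Bool`
and `m ≥ 1`: `W^{≥ m}[sgn(b ⊕ [0 ≤ p])] ≤ 6 m^{−1/2^d} + 3/√m`, uniformly in the number of variables. -/
theorem tailWeight_ptf_le {n d : ℕ} (p : (Fin n → Bool) → ℝ) (hp : fourierDegree p ≤ d) (b : Bool)
    {m : ℕ} (hm : 1 ≤ m) :
    tailWeight (fun x : Fin n → Bool => sgn (xor b (decide (0 ≤ p x)))) m
      ≤ 6 * (m : ℝ) ^ (-(1 / (2 : ℝ) ^ d)) + 3 / Real.sqrt m :=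
  StubPtfRung.tailWeight_ptf_le (fun n m d p hp π => ptf_sum_card_blockFlip_le n m d p hp π) p hp b hm

/-! ### The PTF rung for `λ` and for `μ` -/

/-- **The PTF rung (unconditional): `λ` is orthogonal to every polynomial threshold function of
bounded degree in the binary digits.** For every `d` and `ε > 0`, eventually in `n`: for every real
`p` on `{0,1}ⁿ` with `fourierDegree p ≤ d` and every `b`,
`|Σ_{N<2ⁿ} λ(N) sgn(b ⊕ [0 ≤ p(bits N)])| ≤ ε 2ⁿ`. -/
theorem liouville_orthogonal_ptf (d : ℕ) : ∀ ε : ℝ, 0 < ε → ∀ᶠ n : ℕ in atTop,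
    ∀ (p : (Fin n → Bool) → ℝ), fourierDegree p ≤ d → ∀ b : Bool,
      |∑ N ∈ Finset.range (2 ^ n), ((ArithmeticFunction.liouville N : ℤ) : ℝ) *
          sgn (xor b (decide (0 ≤ p (fun i : Fin n => Nat.testBit N i))))| ≤ ε * (2 : ℝ) ^ n :=
  stub_ptfRung (fun n m d p hp π => ptf_sum_card_blockFlip_le n m d p hp π) d

/-- **Kalai's `TC⁰` conjecture on polynomial threshold functions of bounded degree (unconditional).**
For every `d` and `ε > 0`, eventually in `n`: for every real `p` on `{0,1}ⁿ` with
`fourierDegree p ≤ d` and every `b`, `|Σ_{N<2ⁿ} μ(N) sgn(b ⊕ [0 ≤ p(bits N)])| ≤ ε 2ⁿ`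
(`stub_spectral_moebius` with the uniform tail `tailWeight_ptf_le`). -/
theorem moebius_orthogonal_ptf (d : ℕ) : ∀ ε : ℝ, 0 < ε → ∀ᶠ n : ℕ in atTop,
    ∀ (p : (Fin n → Bool) → ℝ), fourierDegree p ≤ d → ∀ b : Bool,
      |∑ N ∈ Finset.range (2 ^ n), ((ArithmeticFunction.moebius N : ℤ) : ℝ) *
          sgn (xor b (decide (0 ≤ p (fun i : Fin n => Nat.testBit N i))))| ≤ ε * (2 : ℝ) ^ n := by
  intro ε hε
  filter_upwards [stub_spectral_moebius (fun m : ℕ => 6 * (m : ℝ) ^ (-(1 / (2 : ℝ) ^ d)) + 3 / Real.sqrt m)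
    (StubPtfRung.tau_tendsto d) ε hε] with n hn p hp b
  exact hn (fun x : Fin n → Bool => xor b (decide (0 ≤ p x))) (fun m hm => tailWeight_ptf_le p hp b hm)

/-- **The PTF rung in circuit language.** For every `d` and `ε > 0`, eventually in `n`: every circuit
`C` on the `n` digits — over ANY gate basis, of any depth and size — that computes a polynomial
threshold function of Fourier degree `≤ d` (possibly negated) satisfies
`|Σ_{N<2ⁿ} λ(N) sgn C(bits N)| ≤ ε 2ⁿ`. -/
theorem liouville_orthogonal_circuit_ptf (d : ℕ) : ∀ ε : ℝ, 0 < ε → ∀ᶠ n : ℕ in atTop,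
    ∀ C : Circuit (Fin n), (∃ (p : (Fin n → Bool) → ℝ) (b : Bool), fourierDegree p ≤ d ∧
        ∀ x : Fin n → Bool, C.eval x = xor b (decide (0 ≤ p x))) →
      |∑ N ∈ Finset.range (2 ^ n), ((ArithmeticFunction.liouville N : ℤ) : ℝ) *
          sgn (C.eval (fun i : Fin n => Nat.testBit N i))| ≤ ε * (2 : ℝ) ^ n := by
  intro ε hε
  filter_upwards [liouville_orthogonal_ptf d ε hε] with n hn C hC
  obtain ⟨p, b, hp, hC⟩ := hC
  simp only [hC]
  exact hn p hp b

/-- **Kalai's `TC⁰` conjecture in circuit language, PTF case.** For every `d` and `ε > 0`, eventually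
in `n`: every circuit computing a (possibly negated) polynomial threshold function of Fourier degree
`≤ d` of the digits satisfies `|Σ_{N<2ⁿ} μ(N) sgn C(bits N)| ≤ ε 2ⁿ`. -/
theorem moebius_orthogonal_circuit_ptf (d : ℕ) : ∀ ε : ℝ, 0 < ε → ∀ᶠ n : ℕ in atTop,
    ∀ C : Circuit (Fin n), (∃ (p : (Fin n → Bool) → ℝ) (b : Bool), fourierDegree p ≤ d ∧
        ∀ x : Fin n → Bool, C.eval x = xor b (decide (0 ≤ p x))) →
      |∑ N ∈ Finset.range (2 ^ n), ((ArithmeticFunction.moebius N : ℤ) : ℝ) *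
          sgn (C.eval (fun i : Fin n => Nat.testBit N i))| ≤ ε * (2 : ℝ) ^ n := by
  intro ε hε
  filter_upwards [moebius_orthogonal_ptf d ε hε] with n hn C hC
  obtain ⟨p, b, hp, hC⟩ := hC
  simp only [hC]
  exact hn p hp b

/-! ### Kalai's conjecture on linear threshold functions and on bounded-size threshold circuits -/

/-- **Kalai's `TC⁰` conjecture on linear threshold functions of the digits (unconditional).** For
every `ε > 0`, eventually in `n`, every real-weight threshold function of the `n` digits has
`|Σ_{N<2ⁿ} μ(N) sgn [θ ≤ Σ_i w_i bit_i(N)]| ≤ ε 2ⁿ` (Peres' tail `tailWeight_ltf_le` +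
`stub_spectral_moebius`). -/
theorem moebius_orthogonal_ltf : ∀ ε : ℝ, 0 < ε → ∀ᶠ n : ℕ in atTop, ∀ (w : Fin n → ℝ) (θ : ℝ),
    |∑ N ∈ Finset.range (2 ^ n), ((ArithmeticFunction.moebius N : ℤ) : ℝ) *
        sgn (decide (θ ≤ ∑ i, w i * (if Nat.testBit N i then (1 : ℝ) else 0)))|
      ≤ ε * (2 : ℝ) ^ n := by
  intro ε hε
  have hτ : Tendsto (fun m : ℕ => (3 : ℝ) / Real.sqrt m) atTop (𝓝 0) :=
    tendsto_const_nhds.div_atTop (Real.tendsto_sqrt_atTop.comp tendsto_natCast_atTop_atTop)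
  filter_upwards [stub_spectral_moebius (fun m : ℕ => (3 : ℝ) / Real.sqrt m) hτ ε hε] with n hn w θ
  exact hn (fun x : Fin n → Bool => decide (θ ≤ ∑ i, w i * (if x i then (1 : ℝ) else 0)))
    (fun m hm => tailWeight_ltf_le n m hm w θ)

/-- **Kalai's `TC⁰` conjecture on bounded-size threshold circuits (unconditional).** For every `K`
and `ε > 0`, eventually in `n`, every circuit on the `n` digits over `tcBasis` with at most `K` gates
(any depth, any fan-in) has `|Σ_{N<2ⁿ} μ(N) sgn C(bits N)| ≤ ε 2ⁿ` (`tailWeight_circuit_size_le` +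
`stub_spectral_moebius`). -/
theorem moebius_orthogonal_size_le (K : ℕ) : ∀ ε : ℝ, 0 < ε → ∀ᶠ n : ℕ in atTop,
    ∀ C : Circuit (Fin n), C.IsOver tcBasis → C.size ≤ K →
      |∑ N ∈ Finset.range (2 ^ n), ((ArithmeticFunction.moebius N : ℤ) : ℝ) *
          sgn (C.eval (fun i : Fin n => Nat.testBit N i))| ≤ ε * (2 : ℝ) ^ n := by
  intro ε hε
  have hτ : Tendsto (fun m : ℕ => (3 : ℝ) ^ (K + 1) / Real.sqrt m) atTop (𝓝 0) :=
    tendsto_const_nhds.div_atTop (Real.tendsto_sqrt_atTop.comp tendsto_natCast_atTop_atTop)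
  filter_upwards [stub_spectral_moebius (fun m : ℕ => (3 : ℝ) ^ (K + 1) / Real.sqrt m) hτ ε hε]
    with n hn C hB hs
  exact hn (fun y => C.eval y) (fun m hm => tailWeight_circuit_size_le K C hB hs hm)

/-! ### The periodic rung for a general weight, for `λ`, and for `μ` -/

namespace Periodic

/-- If `f 0 = 0`, an `f`-weighted sum over `N < 2^n` equals the sum over `1 ≤ N ≤ 2^n - 1`. -/
theorem sum_range_eq_sum_Icc (f : ℕ → ℝ) (hf : f 0 = 0) (n : ℕ) (F : ℕ → ℝ) :
    ∑ N ∈ range (2 ^ n), f N * F N = ∑ N ∈ Icc 1 (2 ^ n - 1), f N * F N := by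
  symm
  refine Finset.sum_subset (fun N hN => ?_) (fun N hN hN' => ?_)
  · rw [mem_Icc] at hN
    rw [mem_range]
    omega
  · have h0 : N = 0 := by
      rw [mem_range] at hN
      rw [mem_Icc] at hN'
      omega
    subst h0
    simp [hf]

/-- Regrouping by residues: for `q ≥ 1` and `f 0 = 0`,
`Σ_{N < 2^n} f(N) g(N mod q) = Σ_{a < q} g(a) Σ_{1 ≤ N ≤ 2^n - 1, N ≡ a (q)} f(N)`. -/
theorem sum_range_eq_sum_residues (f : ℕ → ℝ) (hf : f 0 = 0) (n : ℕ) {q : ℕ} (hq : 1 ≤ q)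
    (g : ℕ → ℝ) :
    ∑ N ∈ range (2 ^ n), f N * g (N % q) =
      ∑ a ∈ range q, g a *
        ∑ N ∈ (Icc 1 (2 ^ n - 1)).filter (fun N : ℕ => (N : ZMod q) = a), f N := by
  rw [sum_range_eq_sum_Icc f hf, ← Finset.sum_fiberwise_of_maps_to (g := fun N : ℕ => N % q)
    (t := range q) (fun N _ => mem_range.2 (Nat.mod_lt N (by omega)))]
  refine Finset.sum_congr rfl (fun a ha => ?_)
  have haq : a % q = a := Nat.mod_eq_of_lt (mem_range.1 ha)
  rw [Finset.mul_sum]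
  refine Finset.sum_congr (Finset.filter_congr (fun N _ => ?_)) (fun N hN => ?_)
  · simp only [ZMod.natCast_eq_natCast_iff', haq]
  · obtain ⟨-, hN⟩ := Finset.mem_filter.1 hN
    rw [ZMod.natCast_eq_natCast_iff', haq] at hN
    rw [hN, mul_comm]

end Periodic

/-- **The periodic rung for a general weight.** Let `f : ℕ → ℝ` with `f 0 = 0` satisfy a
Siegel–Walfisz bound in arithmetic progressions at level `A + 1`: for some `C`, for all real `x ≥ 2`,
all moduli `1 ≤ q ≤ (log x)^{A+1}` and all residues `a`, `|Σ_{1 ≤ N ≤ x, N ≡ a (q)} f(N)| ≤ C x/(log x)^{A+1}`.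
Then for every `ε > 0`, eventually in `n`: `|Σ_{N<2ⁿ} f(N) g(N mod q)| ≤ ε 2ⁿ` for all `1 ≤ q ≤ n^A`
and all `1`-bounded `g` (the argument of `PeriodicRung.stub_periodic`, verbatim). -/
theorem orthogonal_periodic_of_progression (f : ℕ → ℝ) (hf : f 0 = 0) (A : ℕ)
    (hSW : ∃ C : ℝ, ∀ x : ℝ, 2 ≤ x → ∀ q : ℕ, 1 ≤ q → (q : ℝ) ≤ Real.log x ^ (A + 1) →
      ∀ a : ZMod q, |∑ N ∈ (Icc 1 ⌊x⌋₊).filter (fun N : ℕ => (N : ZMod q) = a), f N| ≤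
        C * x / Real.log x ^ (A + 1)) :
    ∀ ε : ℝ, 0 < ε → ∀ᶠ n : ℕ in atTop, ∀ q : ℕ, 1 ≤ q → q ≤ n ^ A →
      ∀ g : ℕ → ℝ, (∀ a, |g a| ≤ 1) →
        |∑ N ∈ Finset.range (2 ^ n), f N * g (N % q)| ≤ ε * 2 ^ n := by
  intro ε hε
  obtain ⟨C, hC⟩ := hSW
  have hlog2 : 0 < Real.log 2 := Real.log_pos one_lt_two
  have hc0 : 0 < Real.log 2 / 2 := by positivity
  have hC'0 : 0 ≤ max C 1 := zero_le_one.trans (le_max_right _ _)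
  filter_upwards [eventually_ge_atTop 2, tendsto_natCast_atTop_atTop.eventually_ge_atTop
    ((max C 1 / ε + 1) / (Real.log 2 / 2) ^ (A + 1))] with n hn2 hnM
  intro q hq1 hqA g hg
  -- facts about the real point `x = 2^n - 1`
  have hx2 : (2 : ℝ) ≤ ((2 ^ n - 1 : ℕ) : ℝ) := PeriodicRung.StubPeriodic.two_le_cast hn2
  have hx0 : (0 : ℝ) ≤ ((2 ^ n - 1 : ℕ) : ℝ) := Nat.cast_nonneg _
  have hxle : ((2 ^ n - 1 : ℕ) : ℝ) ≤ 2 ^ n := PeriodicRung.StubPeriodic.cast_le_two_pow n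
  have hL : Real.log 2 / 2 * n ≤ Real.log ((2 ^ n - 1 : ℕ) : ℝ) :=
    PeriodicRung.StubPeriodic.log_lower hn2
  have hLpos : 0 < Real.log ((2 ^ n - 1 : ℕ) : ℝ) :=
    lt_of_lt_of_le (mul_pos hc0 (by exact_mod_cast (by omega : 0 < n))) hL
  have hkey : (n : ℝ) ^ A * (max C 1 / ε + 1) ≤ Real.log ((2 ^ n - 1 : ℕ) : ℝ) ^ (A + 1) :=
    PeriodicRung.StubPeriodic.pow_mul_le_pow_succ hc0 hnM hL (Nat.cast_nonneg n)
  have hnA0 : (0 : ℝ) ≤ (n : ℝ) ^ A := by positivity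
  have hqA' : (q : ℝ) ≤ (n : ℝ) ^ A := by exact_mod_cast hqA
  -- admissibility of the modulus: `q ≤ n^A ≤ (log x)^{A+1}`
  have hadm : (q : ℝ) ≤ Real.log ((2 ^ n - 1 : ℕ) : ℝ) ^ (A + 1) :=
    hqA'.trans ((le_mul_of_one_le_right hnA0 (le_add_of_nonneg_left (by positivity))).trans hkey)
  -- the loss: `n^A · C ≤ ε (log x)^{A+1}`
  have hB : (n : ℝ) ^ A * max C 1 ≤ ε * Real.log ((2 ^ n - 1 : ℕ) : ℝ) ^ (A + 1) := by
    have h : (n : ℝ) ^ A * (max C 1 / ε) ≤ Real.log ((2 ^ n - 1 : ℕ) : ℝ) ^ (A + 1) :=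
      (mul_le_mul_of_nonneg_left (le_add_of_nonneg_right zero_le_one) hnA0).trans hkey
    rw [← mul_div_assoc, div_le_iff₀ hε] at h
    linarith
  -- the progression bound in every residue class
  have hSWa : ∀ a ∈ range q,
      |∑ N ∈ (Icc 1 (2 ^ n - 1)).filter (fun N : ℕ => (N : ZMod q) = a), f N| ≤
        max C 1 * ((2 ^ n - 1 : ℕ) : ℝ) / Real.log ((2 ^ n - 1 : ℕ) : ℝ) ^ (A + 1) := by
    intro a _
    have h := hC _ hx2 q hq1 hadm (a : ZMod q)
    rw [Nat.floor_natCast] at h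
    exact h.trans (div_le_div_of_nonneg_right
      (mul_le_mul_of_nonneg_right (le_max_left _ _) hx0) (pow_nonneg hLpos.le _))
  rw [Periodic.sum_range_eq_sum_residues f hf n hq1 g]
  refine (PeriodicRung.StubPeriodic.abs_sum_mul_le hg hSWa).trans ?_
  have hLne : Real.log ((2 ^ n - 1 : ℕ) : ℝ) ^ (A + 1) ≠ 0 := pow_ne_zero _ hLpos.ne'
  calc (q : ℝ) * (max C 1 * ((2 ^ n - 1 : ℕ) : ℝ) / Real.log ((2 ^ n - 1 : ℕ) : ℝ) ^ (A + 1))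
      ≤ (n : ℝ) ^ A * (max C 1 * ((2 ^ n - 1 : ℕ) : ℝ) / Real.log ((2 ^ n - 1 : ℕ) : ℝ) ^ (A + 1)) :=
        mul_le_mul_of_nonneg_right hqA' (div_nonneg (mul_nonneg hC'0 hx0) (pow_nonneg hLpos.le _))
    _ = (n : ℝ) ^ A * max C 1 * ((2 ^ n - 1 : ℕ) : ℝ) / Real.log ((2 ^ n - 1 : ℕ) : ℝ) ^ (A + 1) := by
        ring
    _ ≤ ε * Real.log ((2 ^ n - 1 : ℕ) : ℝ) ^ (A + 1) * ((2 ^ n - 1 : ℕ) : ℝ) /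
          Real.log ((2 ^ n - 1 : ℕ) : ℝ) ^ (A + 1) :=
        div_le_div_of_nonneg_right (mul_le_mul_of_nonneg_right hB hx0) (pow_nonneg hLpos.le _)
    _ = ε * ((2 ^ n - 1 : ℕ) : ℝ) := by
        rw [mul_right_comm, mul_div_assoc, div_self hLne, mul_one]
    _ ≤ ε * 2 ^ n := mul_le_mul_of_nonneg_left hxle hε.le

/-- **The periodic rung for `μ` — Kalai's `TC⁰` conjecture on periodic functions of polynomial period
(unconditional).** For every `A` and `ε > 0`, eventually in `n`: for all moduli `1 ≤ q ≤ n^A` and all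
`1`-bounded `g : ℕ → ℝ`, `|Σ_{N<2ⁿ} μ(N) g(N mod q)| ≤ ε 2ⁿ` (the tree's PROVED Siegel–Walfisz theorem
for `μ`, `SiegelWalfiszMoebius_holds.logPow`, in `orthogonal_periodic_of_progression`). Every function
of `N mod q` is a depth-two majority circuit of size `O(n q)` in the digits. -/
theorem moebius_orthogonal_periodic (A : ℕ) : ∀ ε : ℝ, 0 < ε → ∀ᶠ n : ℕ in atTop,
    ∀ q : ℕ, 1 ≤ q → q ≤ n ^ A → ∀ g : ℕ → ℝ, (∀ a, |g a| ≤ 1) →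
      |∑ N ∈ Finset.range (2 ^ n), (ArithmeticFunction.moebius N : ℝ) * g (N % q)| ≤ ε * 2 ^ n := by
  refine orthogonal_periodic_of_progression (fun N => (ArithmeticFunction.moebius N : ℝ)) (by simp) A ?_
  obtain ⟨C, hC⟩ := SiegelWalfiszMoebius_holds.logPow (A := ((A + 1 : ℕ) : ℝ))
    (Nat.cast_pos.2 (Nat.succ_pos A)) ((A + 1 : ℕ) : ℝ)
  simp only [Real.rpow_natCast] at hC
  exact ⟨C, hC⟩

/-- **The periodic rung in circuit language.** For every `A` and `ε > 0`, eventually in `n`: every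
circuit on the `n` digits (any basis, depth, size) whose value on `bits N` is a `q`-periodic function
of `N < 2ⁿ` for some `1 ≤ q ≤ n^A` satisfies `|Σ_{N<2ⁿ} λ(N) sgn C(bits N)| ≤ ε 2ⁿ`. -/
theorem liouville_orthogonal_circuit_periodic (A : ℕ) : ∀ ε : ℝ, 0 < ε → ∀ᶠ n : ℕ in atTop,
    ∀ C : Circuit (Fin n), (∃ q : ℕ, 1 ≤ q ∧ q ≤ n ^ A ∧ ∃ g : ℕ → Bool, ∀ N : ℕ, N < 2 ^ n →
        C.eval (fun i : Fin n => Nat.testBit N i) = g (N % q)) →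
      |∑ N ∈ Finset.range (2 ^ n), ((ArithmeticFunction.liouville N : ℤ) : ℝ) *
          sgn (C.eval (fun i : Fin n => Nat.testBit N i))| ≤ ε * (2 : ℝ) ^ n := by
  intro ε hε
  filter_upwards [PeriodicRung.stub_periodic A ε hε] with n hn C hC
  obtain ⟨q, hq1, hqn, g, hg⟩ := hC
  rw [Finset.sum_congr rfl fun N hN => by rw [hg N (Finset.mem_range.1 hN)]]
  exact hn q hq1 hqn (fun a => sgn (g a)) (fun a => by unfold sgn; split_ifs <;> simp)

/-- **Kalai's `TC⁰` conjecture in circuit language, periodic case.** For every `A` and `ε > 0`,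
eventually in `n`: every circuit whose value on `bits N` is `q`-periodic in `N < 2ⁿ` for some
`1 ≤ q ≤ n^A` satisfies `|Σ_{N<2ⁿ} μ(N) sgn C(bits N)| ≤ ε 2ⁿ`. -/
theorem moebius_orthogonal_circuit_periodic (A : ℕ) : ∀ ε : ℝ, 0 < ε → ∀ᶠ n : ℕ in atTop,
    ∀ C : Circuit (Fin n), (∃ q : ℕ, 1 ≤ q ∧ q ≤ n ^ A ∧ ∃ g : ℕ → Bool, ∀ N : ℕ, N < 2 ^ n →
        C.eval (fun i : Fin n => Nat.testBit N i) = g (N % q)) →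
      |∑ N ∈ Finset.range (2 ^ n), ((ArithmeticFunction.moebius N : ℤ) : ℝ) *
          sgn (C.eval (fun i : Fin n => Nat.testBit N i))| ≤ ε * (2 : ℝ) ^ n := by
  intro ε hε
  filter_upwards [moebius_orthogonal_periodic A ε hε] with n hn C hC
  obtain ⟨q, hq1, hqn, g, hg⟩ := hC
  rw [Finset.sum_congr rfl fun N hN => by rw [hg N (Finset.mem_range.1 hN)]]
  exact hn q hq1 hqn (fun a => sgn (g a)) (fun a => by unfold sgn; split_ifs <;> simp)

end Summit.QuantumAdvantage.QuantumAdvantage.Theorems.LiouvilleOrthogonalTC0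

end
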